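import Literature.MathematicalPhysics.QuantumLattice.GibbsVariationalPrinciple
import Literature.MathematicalPhysics.QuantumLattice.GibbsChordZeroEntropySlack
import Literature.MathematicalPhysics.QuantumLattice.ConditionalFreeEnergyCertificate
import Literature.MathematicalPhysics.QuantumLattice.HubbardTTPrimeThermalPressureLimit
import HarnessLib

/-!
# The free-energy deficit IS a relative entropy, and the exact anatomy of the slack of a free-energy chord

Topic `Literature/MathematicalPhysics/QuantumLattice` (thermal toolkit; sequel of `GibbsVariationalPrinciple.lean`
and `GibbsChordZeroEntropySlack.lean`). `H` a Hermitian matrix on a finite nonempty index type, `Z_β = tr e^{−βH}`,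
`ρ_β = Z_β⁻¹ e^{−βH}` the Gibbs density, `E_β = Re⟨H⟩_β`, `S_β = log Z_β + β E_β` its entropy, `S(ρ)` the von Neumann
entropy and `D(ρ‖σ) = Re tr ρ(log ρ − log σ)` Umegaki's relative entropy (`quantumRelEntropy` of
`Literature/InformationTheory/Entropy/VonNeumannEntropyInequalities.lean`). Everything is PROVED; no definition,
no named fact.

* §1 `Matrix.IsHermitian.cfc_log_gibbsDensity`: `log ρ_β = −(log Z_β)·1 − βH`; the Gibbs variational principle in
  EQUALITY form `Matrix.IsHermitian.log_partitionFn_sub_trial_eq_quantumRelEntropy`: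
  `log Z_β − (S(ρ) − β Re tr ρH) = D(ρ‖ρ_β)` for every Hermitian `ρ` of trace one — the deficit of a trial state in
  the variational principle is EXACTLY its relative entropy to the Gibbs state (Petz 2008 §3.7 Exercise 13); hence
  `0 ≤ D(ρ‖ρ_β)` for densities (`…quantumRelEntropy_gibbsDensity_nonneg`, Klein's inequality with a Gibbs reference,
  from the tree's variational principle), and the two-temperature value
  `D(ρ_β‖ρ_{β'}) = log Z_{β'} − log Z_β + (β' − β) E_β` (`…quantumRelEntropy_gibbsDensity_gibbsDensity`), which is
  the Bregman divergence of the convex `β ↦ log Z_β` — the convexity slack of the chord.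
* §2 THE ANATOMY OF THE CHORD SLACK. The certified hot chord of the `T > 0` certificate family reads
  `E_β ≤ (u_h − ℓ)/(β − β_h)` from a pressure ceiling `log Z_{β_h} ≤ u_h` at a hot anchor and a free-energy
  ceiling `ℓ ≤ log Z_β` at the target (`Matrix.IsHermitian.energy_window_of_log_partitionFn_bounds`). Its slack is
  EXACTLY (`Matrix.IsHermitian.chord_sub_energy_eq_three_terms`, `β_h ≠ β`)
  `(u_h − ℓ)/(β − β_h) − E_β = [(u_h − log Z_{β_h}) + D(ρ_β‖ρ_{β_h}) + (log Z_β − ℓ)]/(β − β_h)`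
  — hot-certificate error + convexity (a relative entropy of the two Gibbs states) + cold-input deficit, all three
  non-negative — and when `ℓ = S(ρ) − β Re tr ρH` is produced by a trial state the third term is `D(ρ‖ρ_β)`
  (`Matrix.IsHermitian.chord_sub_energy_eq_relEntropy`). One-sided readings for certificate users (no relative
  entropy in the statement): the slack is at least the cold deficit over `β − β_h`
  (`…log_partitionFn_sub_div_le_chord_sub_energy`, `…quantumRelEntropy_div_le_chord_sub_energy`) and at least the hot
  error over `β − β_h` (`…sub_log_partitionFn_div_le_chord_sub_energy`). The zero-entropy special case
  (`ℓ = −β E₀⁺`: slack `≥ (S_β − β(E_β − E₀))/(β − β_h) ≥ T S_β − (E_β − E₀)`) is `GibbsChordZeroEntropySlack.lean`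
  (not restated).
* §3 The same anatomy for THE NUMBER `p(β) = pressureTT' β t t' U n` of the 2D `t–t'` Hubbard model
  (`HubbardTTPrimeThermalPressureLimit.lean`) and every torus-limit thermal state `ω` at `β`
  (`e = e_{Φ(t,t',U)}(ω)`): `(u_h − ℓ)/(β − β_h) − e = [(u_h − p(β_h)) + (p(β_h) − p(β) − (β − β_h)e) + (p(β) − ℓ)]/(β − β_h)`
  with the middle (convexity) term non-negative (`…pressureTT'_convexitySlack_nonneg`), the one-sided readings, and the
  zero-entropy anchor in per-site form: for every `T = 0` row `e(t,t',U,n) ≤ e'` and every hot ceiling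
  `p(β_h) ≤ u_h` (`0 ≤ β_h < β`), `p(β)/β + e' ≤ (u_h + β e')/(β − β_h) − e + … `, precisely
  `…pressureTT'_div_add_le_zeroEntropyChord_sub_meanEnergy`: `(u_h + β e')/(β − β_h) − e ≥ (p(β) + β e(ω))/β − (e(ω) − e')`
  = `T·s_ω − (e(ω) − e')` with `s_ω := p(β) + β e(ω) ≥ 0` the entropy density carried by `ω`.

WHY (the typed limit of technique (ii) of the hubbard-thermal programme, made kernel-exact): at `(U, n, t') = (8t, 7/8, 0)`,
`β t = 4`, the cold input of record is the zero-entropy row #354 (`e' = −0.7059`), `s(t/4) ≈ 0.3–0.45 k_B` and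
`e(t/4) − e' ≈ −0.03·t` [float, LeBlanc–Gull 2013]: every hot anchor `β_h ≤ 3/4` leaves `≥ (0.42…0.57)/3.25 ≈ 0.13–0.18·t`
of slack from the third term ALONE, before the convexity term `D(ρ_4‖ρ_{β_h})/(β − β_h)` (`≈ 0.08·t` at `β_h = 3/4`
[float]) and the hot-certificate error are added; a cluster-product (type-class, «C2») cold input replaces the third
term by `D(ρ_trial‖ρ_β)/(β − β_h)`, the relative entropy PER SITE of the product of open-box Gibbs states to the torus
Gibbs state (boundary kinetic energy `× β`, `≈ 0.14·t × 4` for `3 × 3` boxes [float]) — which is why the energy–entropy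
balance (KMS) functionals, not free-energy chords, carry the `T = t/4` upper edge.

## Mathlib / tree search

REUSED: `Matrix.IsHermitian.vonNeumannEntropy_sub_mul_le_log_partitionFn`, `…vonNeumannEntropy_gibbsDensity`,
`…posSemidef_gibbsDensity`, `Matrix.trace_gibbsDensity(_mul)`, `…energy_le_chord`, `…partitionFn_eq_ofReal`
(`GibbsVariationalPrinciple`, `DuhamelTwoPoint`), `re_trace_mul_cfc_log` (`VonNeumannEntropyInequalities`),
`cfc_log_smul_of_posDef`, `cfc_log_cfc_exp` (`ConditionalFreeEnergyCertificate`),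
`IsTorusLimitOfMixture.meanEnergy_hubbardTTPrime_le_pressureTT'_chord`, `pressureTT'_mem_Icc`
(`HubbardTTPrimeThermalPressureLimit`). Klein's inequality for a positive-definite PAIR is
`trace_sub_trace_le_quantumRelEntropy` (`LiebConcavity`, not restated; §1 is the Gibbs-reference form for a possibly
singular `ρ`). `lean search 'quantumRelEntropy.*gibbs|log_gibbsDensity|chord_sub_energy'`: nothing (2026-08-27).
Presearch: corpus hybrid "relative entropy free energy difference Gibbs state variational principle" →
[corpus: evans1998 p.322] (finite variational principle, no identity); galaxy `Petz` in-book → [galaxy:panama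
316436010500111, §3.7 Exercise 13] = the statement proved in §1.

## References

* D. Petz, *Quantum Information Theory and Quantum Statistics* (2008), §3.7 Exercise 13 (the free energy
  `Tr ρH − β⁻¹S(ρ)` is minimised at the Gibbs state — «use the relative entropy»). [cite: Petz2008, §3.7 Exercise 13]
* M. A. Nielsen, I. L. Chuang, *Quantum Computation and Quantum Information* (2010), Theorem 11.7 (Klein).
  [cite: NielsenChuang2010, Theorem 11.7]
* R. B. Israel, *Convexity in the Theory of Lattice Gases* (1979), Lemma II.3.1 (chords of the pressure).
  [cite: Israel1979, Lemma II.3.1]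
* D. Ruelle, *Statistical Mechanics: Rigorous Results* (1969), §2.5–2.6. [cite: Ruelle1969, §2.5–2.6]
-/

noncomputable section

open scoped Matrix.Norms.L2Operator ComplexOrder
open Finset Literature.InformationTheory.Entropy Literature.MathematicalPhysics.QuantumLattice

namespace Matrix

variable {n : Type*} [Fintype n] [DecidableEq n] [Nonempty n] {H : Matrix n n ℂ}

/-! ### §1 The logarithm of the Gibbs density and the variational principle in equality form -/

/-- **`log ρ_β = −(log Z_β)·1 − βH`** for the Gibbs density `ρ_β = Z_β⁻¹ e^{−βH}` of a Hermitian `H`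
(functional calculus: `log(c·e^{X}) = (log c)·1 + X`). [cite: Petz2008, §3.7 Exercise 13] -/
theorem IsHermitian.cfc_log_gibbsDensity (hH : H.IsHermitian) (β : ℝ) :
    cfc Real.log ((partitionFn β H)⁻¹ • gibbsWeight β H) =
      -(((Real.log (partitionFn β H).re : ℝ) : ℂ) • (1 : Matrix n n ℂ)) - (β : ℂ) • H := by
  set Zr : ℝ := ∑ j, Real.exp (-(β * hH.eigenvalues j)) with hZr_def
  have hZ : partitionFn β H = (Zr : ℂ) := hH.partitionFn_eq_ofReal β
  have hZr : 0 < Zr := sum_pos (fun _ _ => Real.exp_pos _) univ_nonempty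
  have hre : (partitionFn β H).re = Zr := by rw [hZ, Complex.ofReal_re]
  have hinv : (partitionFn β H)⁻¹ = ((Zr⁻¹ : ℝ) : ℂ) := by rw [hZ, Complex.ofReal_inv]
  have hsa : IsSelfAdjoint (-(β : ℂ) • H) := (isHermitian_neg_smul β hH).isSelfAdjoint
  have hexp : gibbsWeight β H = cfc Real.exp (-(β : ℂ) • H) := by
    rw [gibbsWeight, CFC.real_exp_eq_normedSpace_exp]
  rw [hinv, cfc_log_smul_of_posDef (posDef_gibbsWeight β hH) (inv_pos.mpr hZr), hexp,
    cfc_log_cfc_exp (isHermitian_neg_smul β hH), Real.log_inv, hre, Complex.ofReal_neg, neg_smul, neg_smul,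
    sub_eq_add_neg]

/-- **The Gibbs variational principle in EQUALITY form**: for every Hermitian `ρ` of trace one and every real
`β`, `log Z_β(H) − (S(ρ) − β Re tr(ρH)) = D(ρ ‖ ρ_β)` — the deficit of `ρ` in the variational principle
`S(ρ) − β⟨H⟩_ρ ≤ log Z_β` is exactly its Umegaki relative entropy to the Gibbs density `ρ_β = Z_β⁻¹e^{−βH}`
(equivalently `F(ρ) − F(ρ_β) = β⁻¹ D(ρ‖ρ_β)` for the free energy `F(ρ) = tr ρH − β⁻¹S(ρ)`).
[cite: Petz2008, §3.7 Exercise 13] -/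
theorem IsHermitian.log_partitionFn_sub_trial_eq_quantumRelEntropy (hH : H.IsHermitian) (β : ℝ)
    {ρ : Matrix n n ℂ} (hρ : ρ.IsHermitian) (htr : ρ.trace = 1) :
    Real.log (partitionFn β H).re - (vonNeumannEntropy ρ - β * (ρ * H).trace.re) =
      quantumRelEntropy ρ ((partitionFn β H)⁻¹ • gibbsWeight β H) := by
  rw [quantumRelEntropy, Matrix.mul_sub, trace_sub, Complex.sub_re, re_trace_mul_cfc_log hρ,
    hH.cfc_log_gibbsDensity β, Matrix.mul_sub, Matrix.mul_neg, Matrix.mul_smul, Matrix.mul_one,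
    Matrix.mul_smul, trace_sub, trace_neg, trace_smul, trace_smul, htr, smul_eq_mul, mul_one, smul_eq_mul,
    Complex.sub_re, Complex.neg_re, Complex.ofReal_re, Complex.re_ofReal_mul]
  ring

/-- **Klein's inequality with a Gibbs reference, from the variational principle**: for every density matrix `ρ`
(`ρ ≥ 0`, `tr ρ = 1`) and every real `β`, `0 ≤ D(ρ ‖ ρ_β)`. (The tree's `trace_sub_trace_le_quantumRelEntropy` is
Klein for a positive-definite pair; here `ρ` may be singular.) [cite: NielsenChuang2010, Theorem 11.7]
[cite: Petz2008, §3.7 Exercise 13] -/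
theorem IsHermitian.quantumRelEntropy_gibbsDensity_nonneg (hH : H.IsHermitian) (β : ℝ) {ρ : Matrix n n ℂ}
    (hρ : ρ.PosSemidef) (htr : ρ.trace = 1) :
    0 ≤ quantumRelEntropy ρ ((partitionFn β H)⁻¹ • gibbsWeight β H) := by
  rw [← hH.log_partitionFn_sub_trial_eq_quantumRelEntropy β hρ.1 htr]
  have h := hH.vonNeumannEntropy_sub_mul_le_log_partitionFn β hρ htr
  linarith

/-- **The relative entropy of two Gibbs states of the same Hamiltonian** (any real `β, β'`):
`D(ρ_β ‖ ρ_{β'}) = log Z_{β'} − log Z_β + (β' − β) E_β` — the Bregman divergence of the convex `β ↦ log Z_β`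
(whose derivative is `−E_β`) between `β` and `β'`. [cite: Petz2008, §3.7 Exercise 13] [cite: Israel1979, Lemma II.3.1] -/
theorem IsHermitian.quantumRelEntropy_gibbsDensity_gibbsDensity (hH : H.IsHermitian) (β β' : ℝ) :
    quantumRelEntropy ((partitionFn β H)⁻¹ • gibbsWeight β H) ((partitionFn β' H)⁻¹ • gibbsWeight β' H) =
      Real.log (partitionFn β' H).re - Real.log (partitionFn β H).re + (β' - β) * (gibbsState β H H).re := by
  have hρ := hH.posSemidef_gibbsDensity β
  have htr := trace_gibbsDensity β H (partitionFn_pos β hH).ne'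
  have hE : (((partitionFn β H)⁻¹ • gibbsWeight β H) * H).trace.re = (gibbsState β H H).re := by
    rw [trace_gibbsDensity_mul]
  rw [← hH.log_partitionFn_sub_trial_eq_quantumRelEntropy β' hρ.1 htr, hH.vonNeumannEntropy_gibbsDensity β,
    gibbsEntropy_def, hE]
  ring

/-- `0 ≤ D(ρ_β ‖ ρ_{β'})`, i.e. `log Z_{β'} ≥ log Z_β − (β' − β) E_β`: the supporting line of `log Z` at `β` read at
`β'` (this is `log_partitionFn_sub_mul_energy_le` / `energy_le_chord` once more, now as a sign of a relative entropy).
[cite: Israel1979, Lemma II.3.1] -/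
theorem IsHermitian.quantumRelEntropy_gibbsDensity_gibbsDensity_nonneg (hH : H.IsHermitian) (β β' : ℝ) :
    0 ≤ quantumRelEntropy ((partitionFn β H)⁻¹ • gibbsWeight β H) ((partitionFn β' H)⁻¹ • gibbsWeight β' H) :=
  hH.quantumRelEntropy_gibbsDensity_nonneg β' (hH.posSemidef_gibbsDensity β)
    (trace_gibbsDensity β H (partitionFn_pos β hH).ne')

/-! ### §2 The anatomy of the slack of a certified free-energy chord -/

/-- **Exact slack of the chord with a trial-state cold input and the exact hot pressure** (`β_h ≠ β`): with
`ℓ = S(ρ) − β Re tr(ρH)` (Hermitian `ρ`, `tr ρ = 1`),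
`(log Z_{β_h} − ℓ)/(β − β_h) − E_β = (D(ρ_β‖ρ_{β_h}) + D(ρ‖ρ_β))/(β − β_h)`:
convexity slack plus trial deficit, both relative entropies. [cite: Petz2008, §3.7 Exercise 13]
[cite: Israel1979, Lemma II.3.1] -/
theorem IsHermitian.chord_sub_energy_eq_relEntropy (hH : H.IsHermitian) {β βh : ℝ} (hne : βh ≠ β)
    {ρ : Matrix n n ℂ} (hρ : ρ.IsHermitian) (htr : ρ.trace = 1) :
    (Real.log (partitionFn βh H).re - (vonNeumannEntropy ρ - β * (ρ * H).trace.re)) / (β - βh) -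
        (gibbsState β H H).re =
      (quantumRelEntropy ((partitionFn β H)⁻¹ • gibbsWeight β H) ((partitionFn βh H)⁻¹ • gibbsWeight βh H) +
          quantumRelEntropy ρ ((partitionFn β H)⁻¹ • gibbsWeight β H)) / (β - βh) := by
  have hd : β - βh ≠ 0 := sub_ne_zero.mpr (Ne.symm hne)
  rw [hH.quantumRelEntropy_gibbsDensity_gibbsDensity β βh,
    ← hH.log_partitionFn_sub_trial_eq_quantumRelEntropy β hρ htr]
  field_simp
  ring

/-- **The three-term anatomy of the slack of a certified chord** (`β_h ≠ β`; ANY reals `u_h`, `ℓ`):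
`(u_h − ℓ)/(β − β_h) − E_β = [(u_h − log Z_{β_h}) + D(ρ_β‖ρ_{β_h}) + (log Z_β − ℓ)]/(β − β_h)` —
hot-certificate error + convexity + cold-input deficit. For certificates (`log Z_{β_h} ≤ u_h`, `ℓ ≤ log Z_β`,
`β_h < β`) all three are non-negative, and the third is `D(ρ‖ρ_β)` when `ℓ` comes from a trial state
(`log_partitionFn_sub_trial_eq_quantumRelEntropy`). [cite: Israel1979, Lemma II.3.1] [cite: Petz2008, §3.7 Exercise 13] -/
theorem IsHermitian.chord_sub_energy_eq_three_terms (hH : H.IsHermitian) {β βh : ℝ} (hne : βh ≠ β) (uh ℓ : ℝ) :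
    (uh - ℓ) / (β - βh) - (gibbsState β H H).re =
      ((uh - Real.log (partitionFn βh H).re) +
          quantumRelEntropy ((partitionFn β H)⁻¹ • gibbsWeight β H) ((partitionFn βh H)⁻¹ • gibbsWeight βh H) +
          (Real.log (partitionFn β H).re - ℓ)) / (β - βh) := by
  have hd : β - βh ≠ 0 := sub_ne_zero.mpr (Ne.symm hne)
  rw [hH.quantumRelEntropy_gibbsDensity_gibbsDensity β βh]
  field_simp
  ring

/-- **The slack is at least the cold deficit over `β − β_h`**: for `β_h < β` (any real `β`, `β_h`) and ANY hot ceiling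
`log Z_{β_h} ≤ u_h`, every cold input `ℓ` gives `(log Z_β − ℓ)/(β − β_h) ≤ (u_h − ℓ)/(β − β_h) − E_β` —
a free-energy ceiling short of `log Z_β` by `δ` costs at least `δ/(β − β_h) ≥ δ/β` on the certified energy, whatever
the hot anchor. [cite: Israel1979, Lemma II.3.1] -/
theorem IsHermitian.log_partitionFn_sub_div_le_chord_sub_energy (hH : H.IsHermitian) {β βh : ℝ}
    (hlt : βh < β) {uh : ℝ} (huh : Real.log (partitionFn βh H).re ≤ uh) (ℓ : ℝ) :
    (Real.log (partitionFn β H).re - ℓ) / (β - βh) ≤ (uh - ℓ) / (β - βh) - (gibbsState β H H).re := by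
  have hd : 0 < β - βh := sub_pos.mpr hlt
  rw [hH.chord_sub_energy_eq_three_terms hlt.ne uh ℓ]
  exact div_le_div_of_nonneg_right
    (by linarith [hH.quantumRelEntropy_gibbsDensity_gibbsDensity_nonneg β βh]) hd.le

/-- **Trial-state form**: with a trial cold input `ℓ = S(ρ) − β Re tr(ρH)` (Hermitian `ρ`, `tr ρ = 1`),
`D(ρ‖ρ_β)/(β − β_h) ≤ (u_h − ℓ)/(β − β_h) − E_β` (`β_h < β`, `log Z_{β_h} ≤ u_h`): no hot certificate can
recover the relative entropy of the trial state to the Gibbs state. For a product of sub-box Gibbs states this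
relative entropy is the free-energy price of the missing boundary bonds. [cite: Petz2008, §3.7 Exercise 13]
[cite: Israel1979, Lemma II.3.1] -/
theorem IsHermitian.quantumRelEntropy_div_le_chord_sub_energy (hH : H.IsHermitian) {β βh : ℝ}
    (hlt : βh < β) {uh : ℝ} (huh : Real.log (partitionFn βh H).re ≤ uh) {ρ : Matrix n n ℂ}
    (hρ : ρ.IsHermitian) (htr : ρ.trace = 1) :
    quantumRelEntropy ρ ((partitionFn β H)⁻¹ • gibbsWeight β H) / (β - βh) ≤
      (uh - (vonNeumannEntropy ρ - β * (ρ * H).trace.re)) / (β - βh) - (gibbsState β H H).re := by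
  rw [← hH.log_partitionFn_sub_trial_eq_quantumRelEntropy β hρ htr]
  exact hH.log_partitionFn_sub_div_le_chord_sub_energy hlt huh _

/-- **The slack is at least the hot-certificate error over `β − β_h`**: for `β_h < β` and ANY valid cold
input `ℓ ≤ log Z_β`, every hot ceiling `u_h` gives `(u_h − log Z_{β_h})/(β − β_h) ≤ (u_h − ℓ)/(β − β_h) − E_β`.
[cite: Israel1979, Lemma II.3.1] -/
theorem IsHermitian.sub_log_partitionFn_div_le_chord_sub_energy (hH : H.IsHermitian) {β βh : ℝ}
    (hlt : βh < β) {ℓ : ℝ} (hℓ : ℓ ≤ Real.log (partitionFn β H).re) (uh : ℝ) :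
    (uh - Real.log (partitionFn βh H).re) / (β - βh) ≤ (uh - ℓ) / (β - βh) - (gibbsState β H H).re := by
  have hd : 0 < β - βh := sub_pos.mpr hlt
  rw [hH.chord_sub_energy_eq_three_terms hlt.ne uh ℓ]
  exact div_le_div_of_nonneg_right
    (by linarith [hH.quantumRelEntropy_gibbsDensity_gibbsDensity_nonneg β βh]) hd.le

/-- **Both at once**: `[(u_h − log Z_{β_h}) + (log Z_β − ℓ)]/(β − β_h) ≤ (u_h − ℓ)/(β − β_h) − E_β`
(`β_h < β`; no hypothesis on `u_h`, `ℓ` — drop the non-negative convexity term of the anatomy).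
[cite: Israel1979, Lemma II.3.1] -/
theorem IsHermitian.errors_div_le_chord_sub_energy (hH : H.IsHermitian) {β βh : ℝ} (hlt : βh < β)
    (uh ℓ : ℝ) :
    ((uh - Real.log (partitionFn βh H).re) + (Real.log (partitionFn β H).re - ℓ)) / (β - βh) ≤
      (uh - ℓ) / (β - βh) - (gibbsState β H H).re := by
  have hd : 0 < β - βh := sub_pos.mpr hlt
  rw [hH.chord_sub_energy_eq_three_terms hlt.ne uh ℓ]
  exact div_le_div_of_nonneg_right
    (by linarith [hH.quantumRelEntropy_gibbsDensity_gibbsDensity_nonneg β βh]) hd.le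

end Matrix

/-! ### §3 The anatomy for the thermal pressure of the 2D `t–t'` Hubbard model and its torus-limit states -/

namespace Literature.MathematicalPhysics.QuantumLattice

open Matrix HubbardWave0 Literature.Probability.LatticeModels ThermodynamicLimit
open _root_.Filter
open scoped _root_.Topology

namespace InfVolFermionState

variable {t t' U n β : ℝ} {ω : InfVolFermionState 2} {Ls : ℕ → ℕ}

/-- **The convexity slack of the number is non-negative**: for every torus limit `ω` of the canonical sector Gibbs
states at `β` (`U ≥ 0`, `0 ≤ n < 2`, `0 < β_h < β`), `0 ≤ p(β_h) − p(β) − (β − β_h)·e_{Φ(t,t',U)}(ω)` — the TL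
reading of `0 ≤ D(ρ_β‖ρ_{β_h})`. [cite: Israel1979, Lemma II.3.1] -/
theorem IsTorusLimitOfMixture.pressureTT'_convexitySlack_nonneg (hU : 0 ≤ U) (hn0 : 0 ≤ n) (hn2 : n < 2)
    (h : ω.IsTorusLimitOfMixture (sectorGibbsCount n) (fun L => sectorGibbsWeightTT' β t t' U n L)
      (fun L => sectorGibbsVectorTT' t t' U n L) Ls)
    (hLs : Tendsto Ls atTop atTop) {βh : ℝ} (hβh : 0 < βh) (hlt : βh < β) :
    0 ≤ pressureTT' βh t t' U n - pressureTT' β t t' U n -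
      (β - βh) * ω.meanEnergy (hubbardTTPrimeFermionInteraction t t' U) 1 := by
  have hd : 0 < β - βh := sub_pos.mpr hlt
  have hch := h.meanEnergy_hubbardTTPrime_le_pressureTT'_chord hU hn0 hn2 hLs hβh hlt
  rw [le_div_iff₀ hd] at hch
  linarith

/-- **Three-term anatomy for the number** (`β_h ≠ β`; any reals `u_h`, `ℓ`):
`(u_h − ℓ)/(β − β_h) − e(ω) = [(u_h − p(β_h)) + (p(β_h) − p(β) − (β − β_h) e(ω)) + (p(β) − ℓ)]/(β − β_h)`.
[cite: Israel1979, Lemma II.3.1] -/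
theorem IsTorusLimitOfMixture.chord_sub_meanEnergy_eq_three_terms (ω : InfVolFermionState 2) {βh : ℝ}
    (hne : βh ≠ β) (uh ℓ : ℝ) :
    (uh - ℓ) / (β - βh) - ω.meanEnergy (hubbardTTPrimeFermionInteraction t t' U) 1 =
      ((uh - pressureTT' βh t t' U n) +
          (pressureTT' βh t t' U n - pressureTT' β t t' U n -
            (β - βh) * ω.meanEnergy (hubbardTTPrimeFermionInteraction t t' U) 1) +
          (pressureTT' β t t' U n - ℓ)) / (β - βh) := by
  have hd : β - βh ≠ 0 := sub_ne_zero.mpr (Ne.symm hne)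
  field_simp
  ring

/-- **The slack is at least the cold deficit over `β − β_h`, for the number**: for every torus limit `ω` at `β`
(`U ≥ 0`, `0 ≤ n < 2`, `0 < β_h < β`), every hot ceiling `p(β_h) ≤ u_h` and every cold input `ℓ`:
`(p(β) − ℓ)/(β − β_h) ≤ (u_h − ℓ)/(β − β_h) − e(ω)`. A pressure floor short of `p(β)` by `δ` per site (e.g. a
type-class / cluster-product floor missing the boundary bonds) costs `≥ δ/(β − β_h)` on every energy cap built on it.
[cite: Israel1979, Lemma II.3.1] -/
theorem IsTorusLimitOfMixture.pressureTT'_sub_div_le_chord_sub_meanEnergy (hU : 0 ≤ U) (hn0 : 0 ≤ n) (hn2 : n < 2)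
    (h : ω.IsTorusLimitOfMixture (sectorGibbsCount n) (fun L => sectorGibbsWeightTT' β t t' U n L)
      (fun L => sectorGibbsVectorTT' t t' U n L) Ls)
    (hLs : Tendsto Ls atTop atTop) {βh : ℝ} (hβh : 0 < βh) (hlt : βh < β) {uh : ℝ}
    (huh : pressureTT' βh t t' U n ≤ uh) (ℓ : ℝ) :
    (pressureTT' β t t' U n - ℓ) / (β - βh) ≤
      (uh - ℓ) / (β - βh) - ω.meanEnergy (hubbardTTPrimeFermionInteraction t t' U) 1 := by
  have hd : 0 < β - βh := sub_pos.mpr hlt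
  have hcv := h.pressureTT'_convexitySlack_nonneg hU hn0 hn2 hLs hβh hlt
  rw [div_le_iff₀ hd, sub_mul, div_mul_cancel₀ _ hd.ne']
  linarith

/-- **The slack is at least the hot-certificate error over `β − β_h`, for the number** (`0 < β_h < β`, valid cold
input `ℓ ≤ p(β)`): `(u_h − p(β_h))/(β − β_h) ≤ (u_h − ℓ)/(β − β_h) − e(ω)`. [cite: Israel1979, Lemma II.3.1] -/
theorem IsTorusLimitOfMixture.sub_pressureTT'_div_le_chord_sub_meanEnergy (hU : 0 ≤ U) (hn0 : 0 ≤ n) (hn2 : n < 2)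
    (h : ω.IsTorusLimitOfMixture (sectorGibbsCount n) (fun L => sectorGibbsWeightTT' β t t' U n L)
      (fun L => sectorGibbsVectorTT' t t' U n L) Ls)
    (hLs : Tendsto Ls atTop atTop) {βh : ℝ} (hβh : 0 < βh) (hlt : βh < β) {ℓ : ℝ}
    (hℓ : ℓ ≤ pressureTT' β t t' U n) (uh : ℝ) :
    (uh - pressureTT' βh t t' U n) / (β - βh) ≤
      (uh - ℓ) / (β - βh) - ω.meanEnergy (hubbardTTPrimeFermionInteraction t t' U) 1 := by
  have hd : 0 < β - βh := sub_pos.mpr hlt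
  have hcv := h.pressureTT'_convexitySlack_nonneg hU hn0 hn2 hLs hβh hlt
  rw [div_le_iff₀ hd, sub_mul, div_mul_cancel₀ _ hd.ne']
  linarith

/-- **The entropy density carried by a torus-limit thermal state is non-negative**: `0 ≤ p(β) + β e(ω)` for every
torus limit `ω` at `β > 0` (`U ≥ 0`, `0 ≤ n < 2`) — indeed `p(β) ≥ −β e(t,t',U,n)` (the zero-entropy floor) and
`e(ω) ≥ e(t,t',U,n)` (the variational principle). [cite: Ruelle1969, §3.3] -/
theorem IsTorusLimitOfMixture.pressureTT'_add_mul_meanEnergy_nonneg (hU : 0 ≤ U) (hn0 : 0 ≤ n) (hn2 : n < 2)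
    (hβ : 0 < β)
    (h : ω.IsTorusLimitOfMixture (sectorGibbsCount n) (fun L => sectorGibbsWeightTT' β t t' U n L)
      (fun L => sectorGibbsVectorTT' t t' U n L) Ls)
    (hLs : Tendsto Ls atTop atTop) :
    0 ≤ pressureTT' β t t' U n + β * ω.meanEnergy (hubbardTTPrimeFermionInteraction t t' U) 1 := by
  have hp := (pressureTT'_mem_Icc hβ.le t t' hU hn0 hn2).1
  have he := h.energyDensityTT'_le_meanEnergy_of_sectorGibbs t t' U hn0 hn2 β hLs t' hU
  nlinarith [mul_le_mul_of_nonneg_left he hβ.le]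

/-- **The zero-entropy anchor, per site** (`U ≥ 0`, `0 ≤ n < 2`, `0 < β_h < β`): for every `T = 0` row
`e(t,t',U,n) ≤ e'` used as the cold input `ℓ = −β e'` and every hot ceiling `p(β_h) ≤ u_h`, the chord cap exceeds
the energy of every torus-limit thermal state `ω` at `β` by at least `T·s_ω − (e(ω) − e')`, where
`s_ω = p(β) + β e(ω) ≥ 0` is the entropy density carried by `ω`:
`p(β)/β + e' ≤ (u_h + β e')/(β − β_h) − e(ω)` (note `p(β)/β + e' = s_ω/β − (e(ω) − e')`). This is the per-site
form of `Matrix.IsHermitian.energy_add_entropy_div_sub_le_zeroEntropy_chord`. [cite: Israel1979, Lemma II.3.1]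
[cite: GustafsonSigal2003, §18.3 Theorem 18.10] -/
theorem IsTorusLimitOfMixture.pressureTT'_div_add_le_zeroEntropyChord_sub_meanEnergy (hU : 0 ≤ U) (hn0 : 0 ≤ n)
    (hn2 : n < 2)
    (h : ω.IsTorusLimitOfMixture (sectorGibbsCount n) (fun L => sectorGibbsWeightTT' β t t' U n L)
      (fun L => sectorGibbsVectorTT' t t' U n L) Ls)
    (hLs : Tendsto Ls atTop atTop) {βh : ℝ} (hβh : 0 < βh) (hlt : βh < β) {uh e' : ℝ}
    (huh : pressureTT' βh t t' U n ≤ uh) (he' : energyDensityTT' t t' U n ≤ e') :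
    pressureTT' β t t' U n / β + e' ≤
      (uh + β * e') / (β - βh) - ω.meanEnergy (hubbardTTPrimeFermionInteraction t t' U) 1 := by
  have hβ : 0 < β := hβh.trans hlt
  have hd : 0 < β - βh := sub_pos.mpr hlt
  -- the cold deficit with `ℓ = −β e'`
  have h1 := h.pressureTT'_sub_div_le_chord_sub_meanEnergy hU hn0 hn2 hLs hβh hlt huh (-(β * e'))
  have hnum : 0 ≤ pressureTT' β t t' U n + β * e' := by
    have hp := (pressureTT'_mem_Icc hβ.le t t' hU hn0 hn2).1
    nlinarith [mul_le_mul_of_nonneg_left he' hβ.le]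
  -- `x/β ≤ x/(β − β_h)` for `x ≥ 0`
  have hmono : (pressureTT' β t t' U n + β * e') / β ≤ (pressureTT' β t t' U n + β * e') / (β - βh) :=
    div_le_div_of_nonneg_left hnum hd (by linarith)
  have hid : pressureTT' β t t' U n / β + e' = (pressureTT' β t t' U n + β * e') / β := by
    field_simp
  rw [hid]
  have e1 : pressureTT' β t t' U n - -(β * e') = pressureTT' β t t' U n + β * e' := by ring
  have e2 : uh - -(β * e') = uh + β * e' := by ring
  rw [e1, e2] at h1
  exact hmono.trans h1

end InfVolFermionState

end Literature.MathematicalPhysics.QuantumLattice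

end
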